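import Summits.BirchSwinnertonDyer.BirchSwinnertonDyer.Theorems.ByReductionTypeAtTwoAdditiveGammaTwistLayerIsos
import Summits.BirchSwinnertonDyer.BirchSwinnertonDyer.Theorems.ByReductionTypeAtTwoAdditiveSelmerTwistTransport
import Summits.BirchSwinnertonDyer.BirchSwinnertonDyer.Theorems.ByReductionTypeAtTwoAdditiveGammaTwistPackageTransport
import Summits.BirchSwinnertonDyer.BirchSwinnertonDyer.Theorems.ByReductionTypeAtTwoAdditiveOddBranchTwistFEDoor
import HarnessLib

/-!
# Route ByReductionTypeAtTwo, crux C4″ `AdditivePotMultOverKAtTwo` (stmt-BirchSwinnertonDyer-22618; parent 19098) — reading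
# R15 IN THE KERNEL, final assembly: `KatoOddBranchInputsAtTwoNegOneSplitTwistPrintExact ⟹
# KatoOddBranchInputsAtTwoNegTwoSplitTwistPrintExact` UNCONDITIONALLY (the Galois reading (iii) discharged)

Cell `bsd-2adic`, seat `bsd-2adic-k4-w3` GEN 3. The meeting point of pen RC-380/RC-384's one-writer split: the `I`-half
(`exists_iwasawaH1Data_negTwist_two`, this seat, file `…GammaTwistLayerIsos`) and the `D`-half
(`AddSelmerTwistTwo.exists_twist_selmerDualData_two_inv`, seat `bsd-2adic-t42` GEN 22, file `…AdditiveSelmerTwistTransport`)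
of the `Tw`-semilinear identification of the Kato carriers `(𝐇¹_Γ(T₂W₂), X(W₂/ℚ_∞)) ≅ (𝐇¹_Γ(T₂W), X(W/ℚ_∞))` for a globally
minimal model `W₂` of `W^{(2)}` (`exists_negOneAvatar_of_quadraticTwist_two`), fed to GEN 2's
`katoOddBranchInputsNegTwoPrintExact_of_negOne_of_twTransport`:

* `twTransport_of_negTwoSplitTwist` — the hypothesis `hTw` of that theorem, PROVED: for every globally minimal `W` with
  `W^{(−2)}` split multiplicative at `2`, `W[2]` irreducible, cyclotomic `(κ, γ)` and `f` a newform of `W^{(−2)}`, the avatar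
  `W₂` (globally minimal, `W₂^{(−1)}` split multiplicative at `2`, `W₂[2]` irreducible, `f` a newform of `W₂^{(−1)}`) with the
  `Tw`-identifications of both Kato carriers.
* **`katoOddBranchInputsNegTwoPrintExact_of_negOne`** — `KatoOddBranchInputsAtTwoNegOneSplitTwistPrintExact →
  KatoOddBranchInputsAtTwoNegTwoSplitTwistPrintExact` with NO further hypothesis: the `(−2)`-split-twist block's typed
  odd-branch input (addL2x GEN 16 / t42, p684511) is REDUNDANT given the `(−1)`-block's (p683821). R15 is kernel.
* §2 `lengthAt_selmerDualContra_le_of_oddBranchInputsNegOnePrintExact_fe{,_of_lengthAt_symm}` — the two key-`γ⁻¹`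
  PRINT-EXACT doors of the `(−2)`-block (t42 GEN 21's FE-kernel forms `MultOddBranchFE.…NegTwoPrintExact_fe`) RE-KEYED
  ENTIRELY BY `(−1)`-BLOCK DATA: input `KatoOddBranchInputsAtTwoNegOneSplitTwistPrintExact` and an integral multiple
  `L̃ = 2^m·L⁻_2(f,1,ω)` of the UNTWISTED branch; conclusion `ℓ_𝔮(X(W/ℚ_∞)') ≤ ℓ_𝔮(Λ/(Tw L̃))` at every height-one `𝔮 ∌ 2`
  (`Tw L̃` is the corresponding multiple of the `ωχ₂`-branch by GEN 2's `unitTwist_doorMultiple_of_split`).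

HONEST FRAMING (D-0036 / D-0054): theorems only — no definition, no named fact, no instance, no `sorry`; route-independent
(no `Theses` import); shrinks-literal (one typed research-grade input of C4″'s `(−2)`-blocks becomes a theorem modulo the
`(−1)`-block input); closes none; nothing booked; BSD is not proved by any of this. PARTITION: X5@2 additive
potentially-multiplicative block, `(−2)`-split-twist sub-blocks × `p = 2`.

References: [GreenbergLNM1716] §4 p. 107; [Rubin2000] Ch. VI §1–§2; [Kato2004Asterisque] Thm. 12.5 with (12.5.1) (p. 222),
§17.13 (pp. 279–280); [SilvermanAEC2009] X.5 Cor. 5.4, VIII.8 Cor. 8.3.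
-/

set_option autoImplicit false
-- the summit's namespace `Summit.BirchSwinnertonDyer.BirchSwinnertonDyer` (Sub = Summit) trips `dupNamespace`
set_option linter.dupNamespace false

noncomputable section

open scoped MatrixGroups ModularForm

open Field CongruenceSubgroup WeierstrassCurve Literature.NumberTheory.EllipticCurves
  Literature.NumberTheory.EllipticCurves.ModularForms Literature.NumberTheory.EllipticCurves.PadicIntSeries
  Literature.NumberTheory.GaloisRepresentations

namespace Summit.BirchSwinnertonDyer.BirchSwinnertonDyer.Theorems.AddKatoTwoGammaTwist

open Summit.BirchSwinnertonDyer.BirchSwinnertonDyer.Theorems.AddKatoTwo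
open Summit.BirchSwinnertonDyer.BirchSwinnertonDyer.Theorems.AddSelmerTwistTwo (exists_twist_selmerDualData_two_inv)

/-- **The Galois reading (iii) of R15, discharged: the `(−1)`-block avatar with the `Tw`-identifications of both Kato
carriers** — exactly the hypothesis `hTw` of `katoOddBranchInputsNegTwoPrintExact_of_negOne_of_twTransport`. For `W` globally
minimal with `W^{(−2)}` split multiplicative at `2` and `W[2]` irreducible, `(κ, γ)` cyclotomic, `f` a newform of `W^{(−2)}`:
`W₂` := a globally minimal model of `W^{(2)}` (`exists_negOneAvatar_of_quadraticTwist_two`); `𝐇¹_Γ`-twin by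
`exists_iwasawaH1Data_negTwist_two` (this seat); `X(·/ℚ_∞)`-twin keyed `γ⁻¹` by
`AddSelmerTwistTwo.exists_twist_selmerDualData_two_inv` (seat t42). [cite: GreenbergLNM1716, §4 (p. 107)]
[cite: Rubin2000, Ch. VI §1–§2] [cite: SilvermanAEC2009, X.5 Cor. 5.4, VIII.8 Cor. 8.3] -/
theorem twTransport_of_negTwoSplitTwist (W : WeierstrassCurve ℚ) [W.IsElliptic] [W.IsGloballyMinimal]
    [ContinuousSMul ℤ_[2] (W.tateModule 2)]
    {N : ℕ} [NeZero N] (f : CuspForm (Gamma0 N) 2) (κ : ZpExtension ℚ 2) (γ : absoluteGaloisGroup ℚ)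
    (hsp : (W.quadraticTwist (-2)).HasSplitMultiplicativeReductionAtPrime 2) (hirr : W.HasIrreducibleModPGaloisRep 2)
    (hκ : κ.IsCyclotomic) (hγ : κ.IsTopGenerator γ) (_hγ' : IsCyclotomicVariable 2 γ)
    (hf : IsNewformOf (W.quadraticTwist (-2)) f) :
    ∃ (W₂ : WeierstrassCurve ℚ) (_ : W₂.IsElliptic) (_ : W₂.IsGloballyMinimal)
      (_ : ContinuousSMul ℤ_[2] (W₂.tateModule 2)),
      (W₂.quadraticTwist (-1)).HasSplitMultiplicativeReductionAtPrime 2 ∧ W₂.HasIrreducibleModPGaloisRep 2 ∧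
      IsNewformOf (W₂.quadraticTwist (-1)) f ∧
      ∀ (I : Kato2004.IwasawaH1Data W 2 κ γ) (D' : W.SelmerDualData κ γ⁻¹),
        ∃ (I₂ : Kato2004.IwasawaH1Data W₂ 2 κ γ) (D₂' : W₂.SelmerDualData κ γ⁻¹)
          (eI : I₂.H ≃+ I.H) (eD : D₂'.X ≃+ D'.X),
          (∀ (r : IwasawaAlgebra 2) (h : I₂.H), eI (r • h) = unitTwist r (-1) • eI h) ∧
          (∀ (r : IwasawaAlgebra 2) (x : D₂'.X), eD (r • x) = unitTwist r (-1) • eD x) := by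
  obtain ⟨W₂, hE₂, hmin₂, C, hC, hsp_iff, hirr_iff, hnf⟩ := exists_negOneAvatar_of_quadraticTwist_two W
  letI : ContinuousSMul ℤ_[2] (W₂.tateModule 2) := TateModule.continuousSMul_padicInt
  refine ⟨W₂, hE₂, hmin₂, inferInstance, hsp_iff.mpr hsp, hirr_iff.mpr hirr, hnf f hf, fun I D' ↦ ?_⟩
  obtain ⟨I₂, eI, heI⟩ := exists_iwasawaH1Data_negTwist_two W W₂ C hC κ γ hκ hγ I
  obtain ⟨D₂', eD, heD, -⟩ := exists_twist_selmerDualData_two_inv κ hκ W W₂ hC hγ D'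
  exact ⟨I₂, D₂', eI, eD, heI, fun r x ↦ heD r x⟩

/-- **R15 is KERNEL: `KatoOddBranchInputsAtTwoNegOneSplitTwistPrintExact ⟹ KatoOddBranchInputsAtTwoNegTwoSplitTwistPrintExact`**
with no further hypothesis (GEN 2's `katoOddBranchInputsNegTwoPrintExact_of_negOne_of_twTransport` with `hTw` =
`twTransport_of_negTwoSplitTwist`). The `(−2)`-split-twist block's typed print-exact odd-branch input (p684511) is
redundant given the `(−1)`-block's (p683821). [cite: GreenbergLNM1716, §4 (p. 107)] [cite: Rubin2000, Ch. VI §1–§2]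
[cite: Kato2004Asterisque, Thm. 12.5 with (12.5.1) (p. 222), §17.13 (pp. 279–280)] -/
theorem katoOddBranchInputsNegTwoPrintExact_of_negOne (hPE : KatoOddBranchInputsAtTwoNegOneSplitTwistPrintExact) :
    KatoOddBranchInputsAtTwoNegTwoSplitTwistPrintExact :=
  katoOddBranchInputsNegTwoPrintExact_of_negOne_of_twTransport hPE
    fun W _ _ _ _ _ f κ γ hsp hirr hκ hγ hγ' hf ↦
      twTransport_of_negTwoSplitTwist W f κ γ hsp hirr hκ hγ hγ' hf

/-! ## §2 The `(−2)`-block's key-`γ⁻¹` doors re-keyed by `(−1)`-block data (FE in the kernel, t42 GEN 21) -/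

/-- **Key-`γ⁻¹` PRINT-EXACT door of the `(−2)`-block, keyed by `(−1)`-block data.** For `W` globally minimal, additive with
`W^{(−2)}` split multiplicative at `2`, `W[2]` irreducible, `f` the newform of `W^{(−2)}`, `(κ, γ)` cyclotomic, `D'` the key-`γ⁻¹`
dual Selmer datum with `D'.X` finitely generated and `ι(char D'.X) = char D'.X`, and `L̃ ∈ Λ`, `L̃ ≠ 0`, with
`L̃^ℚ = 2^m·L⁻_2(f,1,ω)` (the UNTWISTED one-term minus branch): `ℓ_𝔮(D'.X) ≤ ℓ_𝔮(Λ/(Tw L̃))` at every height-one `𝔮 ∌ 2`,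
GIVEN `Kato2004.thm12_4` and the `(−1)`-block input `KatoOddBranchInputsAtTwoNegOneSplitTwistPrintExact` — by
`MultOddBranchFE.lengthAt_selmerDualContra_le_of_oddBranchInputsNegTwoPrintExact_fe` with `hPE` supplied by
`katoOddBranchInputsNegTwoPrintExact_of_negOne` and `(L̃, m)` transported by `unitTwist_doorMultiple_of_split`
(`(Tw L̃)^ℚ = 2^m·L⁻_2(f,1,ωχ₂)`, `Tw L̃ ≠ 0`). [cite: Kato2004Asterisque, Thm. 12.4 (2) (p. 221), Thm. 12.5 (3) and (12.5.1) (p. 222), §17.13 (pp. 279–280)]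
[cite: GreenbergLNM1716, §4 (p. 107)] [cite: MazurTateTeitelbaum1986Invent, §I.17] -/
theorem lengthAt_selmerDualContra_le_of_oddBranchInputsNegOnePrintExact_fe (h12 : Kato2004.thm12_4)
    (hPE : KatoOddBranchInputsAtTwoNegOneSplitTwistPrintExact)
    (W : WeierstrassCurve ℚ) [W.IsElliptic] [W.IsGloballyMinimal] [ContinuousSMul ℤ_[2] (W.tateModule 2)]
    {N : ℕ} [NeZero N] (f : CuspForm (Gamma0 N) 2) (κ : ZpExtension ℚ 2) (γ : absoluteGaloisGroup ℚ)
    (hsp : (W.quadraticTwist (-2)).HasSplitMultiplicativeReductionAtPrime 2)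
    (hirr : W.HasIrreducibleModPGaloisRep 2) (hκ : κ.IsCyclotomic) (hγ : κ.IsTopGenerator γ)
    (hγ' : IsCyclotomicVariable 2 γ) (hf : IsNewformOf (W.quadraticTwist (-2)) f)
    (I : Kato2004.IwasawaH1Data W 2 κ γ) (D' : W.SelmerDualData κ γ⁻¹) [Module.Finite (IwasawaAlgebra 2) D'.X]
    (hXι : (Module.charIdeal (IwasawaAlgebra 2) D'.X).map (IwasawaAlgebra.invol 2).toRingHom =
      Module.charIdeal (IwasawaAlgebra 2) D'.X)
    (Lt : IwasawaAlgebra 2) (m : ℕ)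
    (hLt : iwasawaToPowerSeries 2 Lt = PowerSeries.C ((2 : ℚ_[2]) ^ m) * padicLFunctionMinusBranchMult f (1 : ℚ_[2]) 1)
    (hLt0 : Lt ≠ 0)
    (𝔮 : PrimeSpectrum (IwasawaAlgebra 2)) (h𝔮 : 𝔮.asIdeal.height = 1)
    (hp𝔮 : PowerSeries.C (2 : ℤ_[2]) ∉ 𝔮.asIdeal) :
    Module.lengthAt (IwasawaAlgebra 2) D'.X 𝔮 ≤
      Module.lengthAt (IwasawaAlgebra 2) (IwasawaAlgebra 2 ⧸ Ideal.span {unitTwist Lt (-1)}) 𝔮 :=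
  MultOddBranchFE.lengthAt_selmerDualContra_le_of_oddBranchInputsNegTwoPrintExact_fe h12
    (katoOddBranchInputsNegTwoPrintExact_of_negOne hPE) W f κ γ hsp hirr hκ hγ hγ' hf I D' hXι (unitTwist Lt (-1)) m
    (unitTwist_doorMultiple_of_split hsp hf hLt).1 ((unitTwist_doorMultiple_of_split hsp hf hLt).2.mpr hLt0) 𝔮 h𝔮 hp𝔮

/-- **Key-`γ⁻¹` PRINT-EXACT door of the `(−2)`-block, LENGTH form, keyed by `(−1)`-block data**: as
`lengthAt_selmerDualContra_le_of_oddBranchInputsNegOnePrintExact_fe` with the symmetry hypothesis in length form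
`ℓ_𝔮(D'.X) = ℓ_{ι𝔮}(D'.X)` (finite generation of `D'.X` not needed), by
`MultOddBranchFE.lengthAt_selmerDualContra_le_of_oddBranchInputsNegTwoPrintExact_of_lengthAt_symm_fe`.
[cite: Kato2004Asterisque, Thm. 12.5 (3) and (12.5.1) (p. 222), §17.13 (pp. 279–280)] [cite: GreenbergLNM1716, §4 (p. 107)]
[cite: MazurTateTeitelbaum1986Invent, §I.17] -/
theorem lengthAt_selmerDualContra_le_of_oddBranchInputsNegOnePrintExact_of_lengthAt_symm_fe (h12 : Kato2004.thm12_4)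
    (hPE : KatoOddBranchInputsAtTwoNegOneSplitTwistPrintExact)
    (W : WeierstrassCurve ℚ) [W.IsElliptic] [W.IsGloballyMinimal] [ContinuousSMul ℤ_[2] (W.tateModule 2)]
    {N : ℕ} [NeZero N] (f : CuspForm (Gamma0 N) 2) (κ : ZpExtension ℚ 2) (γ : absoluteGaloisGroup ℚ)
    (hsp : (W.quadraticTwist (-2)).HasSplitMultiplicativeReductionAtPrime 2)
    (hirr : W.HasIrreducibleModPGaloisRep 2) (hκ : κ.IsCyclotomic) (hγ : κ.IsTopGenerator γ)
    (hγ' : IsCyclotomicVariable 2 γ) (hf : IsNewformOf (W.quadraticTwist (-2)) f)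
    (I : Kato2004.IwasawaH1Data W 2 κ γ) (D' : W.SelmerDualData κ γ⁻¹)
    (Lt : IwasawaAlgebra 2) (m : ℕ)
    (hLt : iwasawaToPowerSeries 2 Lt = PowerSeries.C ((2 : ℚ_[2]) ^ m) * padicLFunctionMinusBranchMult f (1 : ℚ_[2]) 1)
    (hLt0 : Lt ≠ 0)
    (𝔮 : PrimeSpectrum (IwasawaAlgebra 2)) (h𝔮 : 𝔮.asIdeal.height = 1)
    (hp𝔮 : PowerSeries.C (2 : ℤ_[2]) ∉ 𝔮.asIdeal)
    (hXsym : Module.lengthAt (IwasawaAlgebra 2) D'.X 𝔮 =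
      Module.lengthAt (IwasawaAlgebra 2) D'.X (PrimeSpectrum.comap (IwasawaAlgebra.invol 2).toRingHom 𝔮)) :
    Module.lengthAt (IwasawaAlgebra 2) D'.X 𝔮 ≤
      Module.lengthAt (IwasawaAlgebra 2) (IwasawaAlgebra 2 ⧸ Ideal.span {unitTwist Lt (-1)}) 𝔮 :=
  MultOddBranchFE.lengthAt_selmerDualContra_le_of_oddBranchInputsNegTwoPrintExact_of_lengthAt_symm_fe h12
    (katoOddBranchInputsNegTwoPrintExact_of_negOne hPE) W f κ γ hsp hirr hκ hγ hγ' hf I D' (unitTwist Lt (-1)) m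
    (unitTwist_doorMultiple_of_split hsp hf hLt).1 ((unitTwist_doorMultiple_of_split hsp hf hLt).2.mpr hLt0) 𝔮 h𝔮 hp𝔮
    hXsym

end Summit.BirchSwinnertonDyer.BirchSwinnertonDyer.Theorems.AddKatoTwoGammaTwist

end
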